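import Summits.AnomalousDissipation.AnomalousDissipation.Theorems.MarginalStabilityChainStrainedLayerLawLine
import Mathlib.Analysis.Calculus.Deriv.Shift
import Mathlib.Analysis.Calculus.MeanValue

/-! # Stub `stub_pressureRenormalisation` of the line `contraction-capture` (crux stmt-AnomalousDissipation-3007
`MarginalStabilityChain.StrainedLayerLaw`)

The PRESSURE BOOKKEEPING of the period-inheritance step: a class solution `(u, v, p)` of period `nℓ` (`n ≥ 1`)
whose velocity is already `ℓ`-periodic in `x` for `t ≥ 0` lies in the period-`ℓ` class for the re-normalised
pressure `p′ t := p t` (`t > 0`), `p′ t := 0` (`t ≤ 0`).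

Route:
* for `t > 0` every term of the two momentum equations other than `∇p` is `ℓ`-periodic in `x` (slice derivatives
  of `ℓ`-periodic slices via `deriv_comp_add_const`; the time derivative via `Filter.EventuallyEq.deriv_eq`, the time
  lines at `x` and `x + ℓ` agreeing on `(0, ∞) ∋ t`), hence so is `∇p` (`deriv_slice_add_period`,
  `deriv_eq_of_forall_nonneg_eq`);
* the increment `P(x + ℓ, y) − P(x, y)` of the `C¹` slice `P = p t` has vanishing slice derivatives, so it is a
  constant `c` (`is_const_of_deriv_eq_zero`, once in `x`, once in `y`), and `P(x + nℓ, y) = P(x, y) + n c` with the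
  `nℓ`-periodicity of `p` forces `c = 0` (`periodic_of_periodic_slice_derivs`);
* at `t = 0` no equation constrains the pressure: `p′ = p` on `Ioi 0 ×ˢ univ` (`ContDiffOn.congr`), the PDE clauses
  only see `t > 0`, and `p′ 0 = 0` is trivially periodic.
-/

set_option linter.dupNamespace false

noncomputable section

open scoped BigOperators Topology ENNReal
open Filter Set Function MeasureTheory

namespace Summit.AnomalousDissipation.AnomalousDissipation.Theorems.StrainedLayerLaw.ContractionCapture

open Literature.Analysis.FluidPDE Literature.Analysis.FluidPDE.StretchedLayer
open Summit.AnomalousDissipation.AnomalousDissipation.Theses.MarginalStabilityChain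

/-! ## §1 One-variable bookkeeping: periodic slices, time lines -/

/-- The `x`-slice derivative of an `x`-periodic plane field is `x`-periodic, in raw `deriv` form (translation
invariance of `deriv`, no differentiability needed). [folklore] -/
theorem deriv_slice_add_period {f : ℝ → ℝ → ℝ} {ℓ : ℝ} (hf : ∀ x y : ℝ, f (x + ℓ) y = f x y) (x y : ℝ) :
    deriv (fun s => f s y) (x + ℓ) = deriv (fun s => f s y) x := by
  rw [← deriv_comp_add_const (fun s => f s y) ℓ x]
  simp only [hf]

/-- Two time lines that agree for all `s ≥ 0` have the same derivative at every `t > 0` (they agree on the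
neighbourhood `(0, ∞)` of `t`). [folklore] -/
theorem deriv_eq_of_forall_nonneg_eq {F G : ℝ → ℝ} {t : ℝ} (ht : 0 < t) (h : ∀ s : ℝ, 0 ≤ s → F s = G s) :
    deriv F t = deriv G t :=
  Filter.EventuallyEq.deriv_eq
    (Filter.eventuallyEq_of_mem (Ioi_mem_nhds ht) fun s hs => h s (le_of_lt (Set.mem_Ioi.1 hs)))

/-! ## §2 Plane calculus: periodic partials and one multiple period force periodicity -/

/-- **Periodic partials + one multiple period ⇒ periodic.** A `C¹` plane field `P` whose two slice derivatives
are `ℓ`-periodic in `x` (`∂ₓP(x+ℓ, y) = ∂ₓP(x, y)`, `∂_yP(x+ℓ, y) = ∂_yP(x, y)`) and which is `nℓ`-periodic in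
`x` for some `n ≥ 1` is `ℓ`-periodic in `x`: the increment `P(x+ℓ, y) − P(x, y)` has zero `x`- and `y`-slice
derivatives, hence is a constant `c` (`is_const_of_deriv_eq_zero`, twice), and `P(x + nℓ, y) = P(x, y) + n c`
gives `n c = 0`. [folklore] -/
theorem periodic_of_periodic_slice_derivs {P : ℝ → ℝ → ℝ} {ℓ : ℝ} {n : ℕ} (hn : 1 ≤ n)
    (hP : ContDiff ℝ 1 (fun q : ℝ × ℝ => P q.1 q.2))
    (hx : ∀ x y : ℝ, deriv (fun s => P s y) (x + ℓ) = deriv (fun s => P s y) x)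
    (hy : ∀ x y : ℝ, deriv (fun s => P (x + ℓ) s) y = deriv (fun s => P x s) y)
    (hnℓ : ∀ x y : ℝ, P (x + n * ℓ) y = P x y) (x y : ℝ) : P (x + ℓ) y = P x y := by
  have hd : Differentiable ℝ (fun q : ℝ × ℝ => P q.1 q.2) := hP.differentiable one_ne_zero
  -- slices of a `C¹` plane field are differentiable
  have hX : ∀ y : ℝ, Differentiable ℝ (fun s => P (s + ℓ) y) := by
    intro y
    have h2 : Differentiable ℝ (fun s : ℝ => (s + ℓ, y)) := by fun_prop
    have h3 := hd.comp h2
    exact h3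
  have hX0 : ∀ y : ℝ, Differentiable ℝ (fun s => P s y) := by
    intro y
    have h2 : Differentiable ℝ (fun s : ℝ => (s, y)) := by fun_prop
    have h3 := hd.comp h2
    exact h3
  have hY : ∀ x : ℝ, Differentiable ℝ (fun s => P x s) := by
    intro x
    have h2 : Differentiable ℝ (fun s : ℝ => (x, s)) := by fun_prop
    have h3 := hd.comp h2
    exact h3
  -- the increment is constant in `x` ...
  have h1 : ∀ x y : ℝ, P (x + ℓ) y - P x y = P (0 + ℓ) y - P 0 y := by
    intro x y
    have hdiff : Differentiable ℝ (fun s => P (s + ℓ) y - P s y) := (hX y).sub (hX0 y)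
    have hzero : ∀ s : ℝ, deriv (fun s => P (s + ℓ) y - P s y) s = 0 := by
      intro s
      have e : deriv (fun r => P (r + ℓ) y) s = deriv (fun r => P r y) (s + ℓ) :=
        deriv_comp_add_const (fun r => P r y) ℓ s
      rw [deriv_fun_sub (hX y s) (hX0 y s), e, hx, sub_self]
    exact is_const_of_deriv_eq_zero hdiff hzero x 0
  -- ... and constant in `y`
  have h2 : ∀ x y : ℝ, P (x + ℓ) y - P x y = P (x + ℓ) 0 - P x 0 := by
    intro x y
    have hdiff : Differentiable ℝ (fun s => P (x + ℓ) s - P x s) := (hY (x + ℓ)).sub (hY x)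
    have hzero : ∀ s : ℝ, deriv (fun s => P (x + ℓ) s - P x s) s = 0 := by
      intro s
      rw [deriv_fun_sub (hY (x + ℓ) s) (hY x s), hy, sub_self]
    exact is_const_of_deriv_eq_zero hdiff hzero y 0
  obtain ⟨c, hc⟩ : ∃ c : ℝ, ∀ x y : ℝ, P (x + ℓ) y = P x y + c :=
    ⟨P (0 + ℓ) 0 - P 0 0, fun x y => by linarith [h1 x 0, h2 x y]⟩
  -- iterate: `P (x + kℓ, y) = P (x, y) + k c`
  have h4 : ∀ k : ℕ, ∀ x y : ℝ, P (x + k * ℓ) y = P x y + k * c := by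
    intro k
    induction k with
    | zero => intro x y; simp
    | succ k ih =>
      intro x y
      push_cast
      rw [show x + ((k : ℝ) + 1) * ℓ = x + (k : ℝ) * ℓ + ℓ by ring, hc, ih]
      ring
  have h5 : (n : ℝ) * c = 0 := by
    have h6 := h4 n x y
    rw [hnℓ x y] at h6
    linarith
  have hn' : (0 : ℝ) < n := by exact_mod_cast hn
  have hc0 : c = 0 := (mul_eq_zero.1 h5).resolve_left hn'.ne'
  rw [hc, hc0, add_zero]

/-! ## §3 The stub -/

/-- **Stub 1b — PRESSURE RENORMALISATION (true bookkeeping, size M).** If `(u, v, p)` lies in the class with period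
`nℓ` (`n ≥ 1`) and `u, v` are already `ℓ`-periodic in `x` for `t ≥ 0`, then for the re-normalised pressure
`p′ t := p t` (`t > 0`), `p′ t := 0` (`t ≤ 0`) the triple `(u, v, p′)` lies in the class with period `ℓ`: for `t > 0`
the momentum equations make `∇p` `ℓ`-periodic in `x` (every other term is), so `p(t, ·+ℓ, ·) − p(t, ·, ·)` is a
constant `c(t)` and the `nℓ`-periodicity of `p` gives `n c(t) = 0`; at `t = 0` no equation constrains the pressure.
[folklore] -/
theorem stub_pressureRenormalisation {ν ℓ : ℝ} {n : ℕ} {θ₁ θ₂ : ℝ → ℝ → ℝ} {u v p : ℝ → ℝ → ℝ → ℝ}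
    (hn : 1 ≤ n) (h : InClass ν (n * ℓ) θ₁ θ₂ u v p)
    (hper : ∀ t x y : ℝ, 0 ≤ t → u t (x + ℓ) y = u t x y ∧ v t (x + ℓ) y = v t x y) :
    ∃ p' : ℝ → ℝ → ℝ → ℝ, InClass ν ℓ θ₁ θ₂ u v p' := by
  dsimp only [InClass] at h
  obtain ⟨hu, hv, hp, hu0, hv0, hpde, hperL, hfar, hdat⟩ := h
  -- THE CONTENT: `p` itself is `ℓ`-periodic in `x` for `t > 0`
  have hpper : ∀ t : ℝ, 0 < t → ∀ x y : ℝ, p t (x + ℓ) y = p t x y := by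
    intro t ht
    have hU : ∀ x y : ℝ, u t (x + ℓ) y = u t x y := fun x y => (hper t x y ht.le).1
    have hV : ∀ x y : ℝ, v t (x + ℓ) y = v t x y := fun x y => (hper t x y ht.le).2
    have hUx : ∀ x y : ℝ, deriv (fun s => u t s y) (x + ℓ) = deriv (fun s => u t s y) x :=
      deriv_slice_add_period hU
    have hVx : ∀ x y : ℝ, deriv (fun s => v t s y) (x + ℓ) = deriv (fun s => v t s y) x :=
      deriv_slice_add_period hV
    have hUxx : ∀ x y : ℝ, deriv (fun s => deriv (fun r => u t r y) s) (x + ℓ) =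
        deriv (fun s => deriv (fun r => u t r y) s) x :=
      deriv_slice_add_period (f := fun s y => deriv (fun r => u t r y) s) hUx
    have hVxx : ∀ x y : ℝ, deriv (fun s => deriv (fun r => v t r y) s) (x + ℓ) =
        deriv (fun s => deriv (fun r => v t r y) s) x :=
      deriv_slice_add_period (f := fun s y => deriv (fun r => v t r y) s) hVx
    have hUt : ∀ x y : ℝ, deriv (fun s => u s (x + ℓ) y) t = deriv (fun s => u s x y) t :=
      fun x y => deriv_eq_of_forall_nonneg_eq ht fun s hs => (hper s x y hs).1
    have hVt : ∀ x y : ℝ, deriv (fun s => v s (x + ℓ) y) t = deriv (fun s => v s x y) t :=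
      fun x y => deriv_eq_of_forall_nonneg_eq ht fun s hs => (hper s x y hs).2
    -- `∂ₓp` is `ℓ`-periodic: the `x`-momentum equation at `(t, x + ℓ, y)` and at `(t, x, y)`
    have hPx : ∀ x y : ℝ, deriv (fun s => p t s y) (x + ℓ) = deriv (fun s => p t s y) x := by
      intro x y
      have e1 := (hpde t (x + ℓ) y ht).1
      have e2 := (hpde t x y ht).1
      simp only [hU, hV, hUx, hUxx, hUt] at e1
      linarith
    -- `∂_yp` is `ℓ`-periodic: the `y`-momentum equation at `(t, x + ℓ, y)` and at `(t, x, y)`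
    have hPy : ∀ x y : ℝ, deriv (fun s => p t (x + ℓ) s) y = deriv (fun s => p t x s) y := by
      intro x y
      have e1 := (hpde t (x + ℓ) y ht).2.1
      have e2 := (hpde t x y ht).2.1
      simp only [hU, hV, hVx, hVxx, hVt] at e1
      linarith
    exact periodic_of_periodic_slice_derivs hn (contDiff_slice hp (Set.mem_Ioi.2 ht)) hPx hPy
      (fun x y => (hperL t x y ht.le).2.2)
  refine ⟨fun t x y => if 0 < t then p t x y else 0, ?_⟩
  dsimp only [InClass]
  refine ⟨hu, hv, ?_, hu0, hv0, ?_, ?_, hfar, hdat⟩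
  · -- `p′ = p` on `t > 0`
    exact hp.congr fun q hq => if_pos (Set.mem_prod.1 hq).1
  · -- the equations only see `t > 0`, where `p′ t = p t`
    intro t x y ht
    simp only [if_pos ht]
    exact hpde t x y ht
  · -- periodicity with period `ℓ`
    intro t x y ht
    refine ⟨(hper t x y ht).1, (hper t x y ht).2, ?_⟩
    rcases ht.eq_or_lt with h0 | hpos
    · subst h0
      simp
    · simp only [if_pos hpos]
      exact hpper t hpos x y

end Summit.AnomalousDissipation.AnomalousDissipation.Theorems.StrainedLayerLaw.ContractionCapture

end
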